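import Summits.CriticalPhenomena.PercolationContinuityZ3.Theorems.PercNearOneGluingAdditiveGluingTripleTieRaise
import HarnessLib

/-!
# Crux `PercNearOneGluing.AdditiveGluing` (stmt-CriticalPhenomena-4576): the crux at the tie locus reduces to instances with a
# TRIPLE tie at the minimum (two relay-gluing raises, Kozma–Nitzan Lemma 4)

Support file (`--supports stmt-CriticalPhenomena-4576`, lead prim-png-lead-4576).  No definitions, no named facts, no sorries.

The landed minimiser-tie reduction (`additiveGluing_pointwise_of_minTie`, Kozma–Nitzan §5.3 run on the minimiser) leaves the
instances in which the two least reliable relays `a, a'` tie.  **Theorem (`additiveGluing_tie_of_tripleTie`).**  For fixed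
`n, A, o, b` with `3 ≤ |A ∖ b|`, the additive gluing inequality at every such tie instance follows from the instances in which
THREE distinct relays tie at the minimum of `μ(· ↔ b)` on `A`.

Proof: raise the weight of the tied pair `{a, a'}` (`tripleTie_raise`): the additive margin only grows (Lemma 4), `a, a'` stay
tied and minimal, and the first event is either a catch (a third relay comes down to the tie: triple tie) or the glued pair
(`w(a,a') = 1`); in the latter case raise the pair `{a, c}` for any third relay `c`: the first event is again a catch (triple tie
`{a, a', d}`, the glued `a'` follows `a`) or `c` glued as well (triple tie `{a, a', c}`).  Corollaries: the v12 stub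
`stub_additiveGluingTieFour_pl` follows from its triple-tie restriction (`additiveGluingTieFour_of_tripleTieFour`), and the crux
follows from the FULL-tie three-relay E-form together with the triple-tie instances with at least four relays
(`additiveGluing_of_threeFullTieForm_and_tripleTieFour`).  [cite: KozmaNitzan2024, Lemma 4 / eq. (9) (pp. 9–10), §5.3 (p. 34)]
-/

namespace Summit.CriticalPhenomena.PercolationContinuityZ3.Theorems

open MeasureTheory Set Literature.Probability.LatticeModels Literature.Probability.Percolation

noncomputable section
open Classical

variable {n : ℕ}

/-- **Tie instances follow from triple-tie instances** (fixed `n, A, o, b`, `3 ≤ |A ∖ b|`); see the file header.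
[cite: KozmaNitzan2024, Lemma 4 (p. 9), §5.3 (p. 34)] -/
theorem additiveGluing_tie_of_tripleTie (A : Finset (Fin n)) (o b : Fin n) (hcard : 3 ≤ (A.erase b).card)
    (h3 : ∀ (w : Sym2 (Fin n) → unitInterval) (t : ℝ),
      (∃ a ∈ A, ∃ a' ∈ A, ∃ a'' ∈ A, a ≠ a' ∧ a ≠ a'' ∧ a' ≠ a'' ∧
        (prodBernoulli w).real (openConn a b) = (prodBernoulli w).real (openConn a' b) ∧
        (prodBernoulli w).real (openConn a b) = (prodBernoulli w).real (openConn a'' b) ∧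
        ∀ c ∈ A, (prodBernoulli w).real (openConn a b) ≤ (prodBernoulli w).real (openConn c b)) →
      0 ≤ t → (∀ c ∈ A, 1 - t ≤ (prodBernoulli w).real (openConn c b)) →
      (prodBernoulli w).real (⋃ c ∈ A, openConn o c) - t ≤ (prodBernoulli w).real (openConn o b)) :
    ∀ (w : Sym2 (Fin n) → unitInterval) (t : ℝ),
      (∃ a ∈ A, ∃ a' ∈ A, a ≠ a' ∧ (prodBernoulli w).real (openConn a b) = (prodBernoulli w).real (openConn a' b) ∧
        ∀ c ∈ A, (prodBernoulli w).real (openConn a b) ≤ (prodBernoulli w).real (openConn c b)) →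
      0 ≤ t → (∀ c ∈ A, 1 - t ≤ (prodBernoulli w).real (openConn c b)) →
      (prodBernoulli w).real (⋃ c ∈ A, openConn o c) - t ≤ (prodBernoulli w).real (openConn o b) := by
  intro w t htie ht0 hrel
  obtain ⟨a, ha, a', ha', haa', htie, hmin⟩ := htie
  -- already a triple tie?
  by_cases h3x : ∃ c ∈ A, c ≠ a ∧ c ≠ a' ∧ (prodBernoulli w).real (openConn c b) = (prodBernoulli w).real (openConn a b)
  · obtain ⟨c, hc, hca, hca', hceq⟩ := h3x
    exact h3 w t ⟨a, ha, a', ha', c, hc, haa', hca.symm, hca'.symm, htie, hceq.symm, hmin⟩ ht0 hrel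
  push Not at h3x
  have hstrict : ∀ c ∈ A, c ≠ a → c ≠ a' →
      (prodBernoulli w).real (openConn a b) < (prodBernoulli w).real (openConn c b) :=
    fun c hc hca hca' => lt_of_le_of_ne (hmin c hc) (fun h => h3x c hc hca hca' h.symm)
  -- RAISE 1: the tied pair `{a, a'}`
  have hsplit₁ : ∀ c ∈ A, (prodBernoulli w).real (openConn a b) < (prodBernoulli w).real (openConn c b) ∨ c = a ∨ c = a' ∨
      (c ≠ a ∧ w s(c, a) = 1) := by
    intro c hc
    by_cases hca : c = a
    · exact Or.inr (Or.inl hca)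
    by_cases hca' : c = a'
    · exact Or.inr (Or.inr (Or.inl hca'))
    exact Or.inl (hstrict c hc hca hca')
  obtain ⟨w', hoff, hmin', hyle, hΔ, hOA, hgain, hcase⟩ := tripleTie_raise w A o b a a' ha ha' (Ne.symm haa') hmin hsplit₁
  have htie' : (prodBernoulli w').real (openConn a' b) = (prodBernoulli w').real (openConn a b) := by
    have h1 := hmin' a' ha'
    linarith
  have hrel' : ∀ c ∈ A, 1 - (t - ((prodBernoulli w').real (openConn a b) - (prodBernoulli w).real (openConn a b))) ≤
      (prodBernoulli w').real (openConn c b) := by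
    intro c hc
    have h1 := hrel a ha
    have h2 := hmin' c hc
    linarith
  have ht0' : 0 ≤ t - ((prodBernoulli w').real (openConn a b) - (prodBernoulli w).real (openConn a b)) := by
    have h1 := hrel a ha
    linarith [measureReal_le_one (μ := prodBernoulli w') (s := openConn a b)]
  rcases hcase with ⟨d, hd, hlt, hdeq⟩ | ⟨hglue, _, hstrict'⟩
  · -- a catch: triple tie `{a, a', d}` at `w'`
    have hda : a ≠ d := fun h => by rw [h] at hlt; exact lt_irrefl _ hlt
    have hda' : a' ≠ d := fun h => by rw [← h, htie] at hlt; exact lt_irrefl _ hlt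
    have hcl := h3 w' _ ⟨a, ha, a', ha', d, hd, haa', hda, hda', htie'.symm, hdeq.symm, hmin'⟩ ht0' hrel'
    linarith
  · -- the pair is glued; RAISE 2 with a third relay `c`
    have hex : ∃ c ∈ A, c ≠ a ∧ c ≠ a' := by
      have h1 : 1 ≤ ((A.erase a).erase a').card := by
        have e1 := Finset.pred_card_le_card_erase (s := A) (a := a)
        have e2 := Finset.pred_card_le_card_erase (s := A.erase a) (a := a')
        have e3 := Finset.card_erase_le (s := A) (a := b)
        omega
      obtain ⟨c, hc⟩ := Finset.card_pos.1 h1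
      rcases Finset.mem_erase.1 hc with ⟨hca', hc⟩
      rcases Finset.mem_erase.1 hc with ⟨hca, hc⟩
      exact ⟨c, hc, hca, hca'⟩
    obtain ⟨c, hc, hca, hca'⟩ := hex
    have hsplit₂ : ∀ c' ∈ A, (prodBernoulli w').real (openConn a b) < (prodBernoulli w').real (openConn c' b) ∨ c' = a ∨
        c' = c ∨ (c' ≠ a ∧ w' s(c', a) = 1) := by
      intro c' hc'
      by_cases h1 : c' = a
      · exact Or.inr (Or.inl h1)
      by_cases h2 : c' = c
      · exact Or.inr (Or.inr (Or.inl h2))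
      by_cases h3' : c' = a'
      · subst h3'; exact Or.inr (Or.inr (Or.inr ⟨h1, hglue⟩))
      exact Or.inl (hstrict' c' hc' (hstrict c' hc' h1 h3'))
    obtain ⟨w'', hoff2, hmin'', _, hΔ2, hOA2, hgain2, hcase2⟩ := tripleTie_raise w' A o b a c ha hc hca hmin' hsplit₂
    -- `a'` stays glued to `a`
    have hne : s(a', a) ≠ s(c, a) := by
      rw [Ne, Sym2.eq_iff]
      push Not
      exact ⟨fun h _ => hca' h.symm, fun h => absurd h.symm haa'⟩
    have hglue'' : w'' s(a', a) = 1 := by rw [hoff2 _ hne, hglue]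
    have htie'' : (prodBernoulli w'').real (openConn a' b) = (prodBernoulli w'').real (openConn a b) :=
      tripleTie_tau_eq_of_weight_one w'' (Ne.symm haa') hglue'' b
    have hrel'' : ∀ c' ∈ A, 1 - (t - ((prodBernoulli w').real (openConn a b) - (prodBernoulli w).real (openConn a b)) -
        ((prodBernoulli w'').real (openConn a b) - (prodBernoulli w').real (openConn a b))) ≤
        (prodBernoulli w'').real (openConn c' b) := by
      intro c' hc'
      have h1 := hrel a ha
      have h2 := hmin'' c' hc'
      linarith
    have ht0'' : 0 ≤ t - ((prodBernoulli w').real (openConn a b) - (prodBernoulli w).real (openConn a b)) -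
        ((prodBernoulli w'').real (openConn a b) - (prodBernoulli w').real (openConn a b)) := by
      have h1 := hrel a ha
      linarith [measureReal_le_one (μ := prodBernoulli w'') (s := openConn a b)]
    rcases hcase2 with ⟨d, hd, hlt2, hdeq2⟩ | ⟨_, hceq, _⟩
    · -- a catch: triple tie `{a, a', d}` at `w''`
      have hda : a ≠ d := fun h => by rw [h] at hlt2; exact lt_irrefl _ hlt2
      have hda' : a' ≠ d := fun h => by rw [← h, htie'] at hlt2; exact lt_irrefl _ hlt2
      have hcl := h3 w'' _ ⟨a, ha, a', ha', d, hd, haa', hda, hda', htie''.symm, hdeq2.symm, hmin''⟩ ht0'' hrel''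
      linarith
    · -- `c` glued as well: triple tie `{a, a', c}` at `w''`
      have hcl := h3 w'' _ ⟨a, ha, a', ha', c, hc, haa', Ne.symm hca, Ne.symm hca', htie''.symm, hceq.symm, hmin''⟩ ht0'' hrel''
      linarith

/-- **The v12 stub `stub_additiveGluingTieFour_pl` follows from its restriction to a TRIPLE tie at the minimum.**
[cite: KozmaNitzan2024, §5.3 (p. 34)] -/
theorem additiveGluingTieFour_of_tripleTieFour
    (hT : ∀ (n : ℕ) (w : Sym2 (Fin n) → unitInterval) (A : Finset (Fin n)) (o b : Fin n) (t : ℝ),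
      4 ≤ (A.erase b).card →
      (∃ a ∈ A, ∃ a' ∈ A, ∃ a'' ∈ A, a ≠ a' ∧ a ≠ a'' ∧ a' ≠ a'' ∧
        (prodBernoulli w).real (openConn a b) = (prodBernoulli w).real (openConn a' b) ∧
        (prodBernoulli w).real (openConn a b) = (prodBernoulli w).real (openConn a'' b) ∧
        ∀ c ∈ A, (prodBernoulli w).real (openConn a b) ≤ (prodBernoulli w).real (openConn c b)) →
      0 ≤ t → (∀ a ∈ A, 1 - t ≤ (prodBernoulli w).real (openConn a b)) →
      (prodBernoulli w).real (⋃ a ∈ A, openConn o a) - t ≤ (prodBernoulli w).real (openConn o b)) :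
    ∀ (n : ℕ) (w : Sym2 (Fin n) → unitInterval) (A : Finset (Fin n)) (o b : Fin n) (t : ℝ),
      4 ≤ (A.erase b).card →
      (∃ a ∈ A, ∃ a' ∈ A, a ≠ a' ∧ (prodBernoulli w).real (openConn a b) = (prodBernoulli w).real (openConn a' b) ∧
        ∀ c ∈ A, (prodBernoulli w).real (openConn a b) ≤ (prodBernoulli w).real (openConn c b)) →
      0 ≤ t → (∀ a ∈ A, 1 - t ≤ (prodBernoulli w).real (openConn a b)) →
      (prodBernoulli w).real (⋃ a ∈ A, openConn o a) - t ≤ (prodBernoulli w).real (openConn o b) := by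
  intro n w A o b t h4 htie ht0 hrel
  exact additiveGluing_tie_of_tripleTie A o b (by omega) (fun w' t' h3' => hT n w' A o b t' h4 h3') w t htie ht0 hrel

/-- **`AdditiveGluing` from the FULL-tie three-relay E-form and the TRIPLE-tie instances with at least four relays**
(candidate skeleton composition: both hypotheses are strictly weaker than the two stubs of skeleton v12).
[cite: KozmaNitzan2024, Lemma 4 (p. 9), Theorem 1 (§3.1), §5.3 (p. 34)] -/
theorem additiveGluing_of_threeFullTieForm_and_tripleTieFour
    (h3full : ∀ (n : ℕ) (w : Sym2 (Fin n) → unitInterval) (o b a₁ a₂ a₃ : Fin n) (t : ℝ),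
      a₁ ≠ a₂ → a₁ ≠ a₃ → a₂ ≠ a₃ →
      1 - t ≤ (prodBernoulli w).real (openConn a₃ b) →
      (prodBernoulli w).real (openConn a₃ b) ≤ (prodBernoulli w).real (openConn a₁ b) →
      (prodBernoulli w).real (openConn a₃ b) ≤ (prodBernoulli w).real (openConn a₂ b) →
      (prodBernoulli w).real (openConn a₁ b) ≤ (prodBernoulli w).real (openConn a₃ b) →
      (prodBernoulli w).real (openConn a₂ b) ≤ (prodBernoulli w).real (openConn a₃ b) →
      (prodBernoulli w).real ((openConn o a₁ ∪ openConn o a₂ ∪ openConn o a₃) \ openConn o b) ≤ t)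
    (hT : ∀ (n : ℕ) (w : Sym2 (Fin n) → unitInterval) (A : Finset (Fin n)) (o b : Fin n) (t : ℝ),
      4 ≤ (A.erase b).card →
      (∃ a ∈ A, ∃ a' ∈ A, ∃ a'' ∈ A, a ≠ a' ∧ a ≠ a'' ∧ a' ≠ a'' ∧
        (prodBernoulli w).real (openConn a b) = (prodBernoulli w).real (openConn a' b) ∧
        (prodBernoulli w).real (openConn a b) = (prodBernoulli w).real (openConn a'' b) ∧
        ∀ c ∈ A, (prodBernoulli w).real (openConn a b) ≤ (prodBernoulli w).real (openConn c b)) →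
      0 ≤ t → (∀ a ∈ A, 1 - t ≤ (prodBernoulli w).real (openConn a b)) →
      (prodBernoulli w).real (⋃ a ∈ A, openConn o a) - t ≤ (prodBernoulli w).real (openConn o b)) :
    Summit.CriticalPhenomena.PercolationContinuityZ3.Theses.PercNearOneGluing.AdditiveGluing :=
  additiveGluing_of_threeFullTieForm_and_four h3full (additiveGluingTieFour_of_tripleTieFour hT)

end

end Summit.CriticalPhenomena.PercolationContinuityZ3.Theorems
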